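import Summits.RiemannHypothesis.RiemannHypothesis.Theorems.Splittings.NbSharpConstant
import Literature.NumberTheory.LFunctions.ZetaZeroReciprocalSum
import Literature.NumberTheory.LFunctions.BettinConreyFarmer2013Proofs
import HarnessLib

/-!
# Splittings / NB — the PRINTED sharp constant `2+γ−log 4π`, hypothesis-free (Rosser's identity discharged)

Cell rh-split, seat rh-split-nb-neg g5 (card `SPLIT-nb-neg.md` §11; census row V23).

`Splittings.NbSharpConstant.rh_and_simple_of_sharpRate_numeric` (g4) proved
`SharpRateNumeric → RiemannHypothesis ∧ «all nontrivial zeros simple»` for the PRINTED constant of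
BDBLS 2000 / Landreau–Richard Conj. 1.4 / Bettin–Conrey–Farmer 2013 Thm 1,

  `SharpRateNumeric :≡ ∀ ε > 0, ∀ᶠ N, ∃ a, I(N,a) ≤ (2π(2+γ−log 4π) + ε)/log N`,

MODULO the explicit hypothesis `hRosser : RH → Σ_ρ m_ρ/|ρ|² = 2+γ−log 4π` ("Rosser 1939 p. 29" as quoted
by Landreau–Richard 2002 p. 2).  That identity IS in the tree, RH-conditionally and with multiplicity,
as `Literature.NumberTheory.LFunctions.hasSum_zeroOrder_div_norm_sq_of_RH` (Nicolas 2012 (1.3)/(1.19):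
under RH `ρ(1−ρ) = |ρ|²`, and `Σ_ρ m_ρ/(ρ(1−ρ)) = β = 2+γ−log π−2 log 2` RH-free,
`hasSum_zeroOrder_div_mul_one_sub`).  This file discharges `hRosser`:

* `zeroSum_mult_div_normSq_eq_of_rh` — `RH → Σ'_ρ m_ρ/‖ρ‖² = 2+γ−log 4π` (the hypothesis verbatim);
* `rh_and_simple_of_sharpRate_printed` — **`SharpRateNumeric → RH ∧ ∀ ρ, m_ρ = 1`, hypothesis-free**;
* `rh_and_simple_of_natural_sharpRate_printed` — the same for the natural approximants
  `V_N = Σ_{n≤N} μ(n)(1 − log n/log N) n^{-s}` with the printed constant, i.e. literally the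
  CONCLUSION of Bettin–Conrey–Farmer 2013 Thm 1 (limsup half) implies RH and the simplicity that its
  hypothesis (2) «implicitly assumes» (p. 3);
* `rh_and_simple_of_sharpTail_exact` — the ε-FREE tail `∀ N ≥ H, ∃ a, I(N,a) ≤ 2π(2+γ−log 4π)/log N`
  (census V27) forces RH ∧ simplicity as well (it implies `SharpRateNumeric`);
* `zeroSumInvNormSq_eq_printed_of_sharpRate_printed` — under `SharpRateNumeric` the BDBLS constant
  `S₁ = Σ_ρ 1/|ρ|²` (`Literature.Barriers.RiemannHypothesis.zeroSumInvNormSq`) EQUALS `2+γ−log 4π`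
  (so the two printed forms of (*) coincide exactly when they can hold at all);
* `zeroSumInvNormSq_le_printed_of_rh` — under RH alone, `S₁ ≤ 2+γ−log 4π` (termwise `1 ≤ m_ρ`).

SPLITTING READING (lens neg, census V23): the label «(*) ⟹ RH ∧ simple zeros» now holds for the
printed numeric constant WITHOUT any identity hypothesis: as a tail conjunct, (*) is RH-PLUS
(RH ∧ simplicity), kernel-certified.  No definitions; RH-free proofs; std axioms expected.

References: Landreau–Richard, Exp. Math. 11 (2002) 349–360, Conj. 1.4 and p. 2 (Rosser's identity)
[corpus:paper:landreau2002 p.2–3]; Bettin–Conrey–Farmer, arXiv:1211.5191, Thm 1 and p. 3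
[corpus:paper:arxiv-1211.5191 p.1–3]; Nicolas, Acta Arith. 152 (2012), (1.3), (1.19); Burnol,
arXiv:math/0103058, Thm 1.3.

HONEST LABEL: «SPLITTING SEARCH over kernel-typed RH-EQUIVALENCES; a splitting A ∧ B ⟹ RH is
CONDITIONAL bookkeeping unless A and B are both proved; nothing here bears on the truth of RH.»
-/

noncomputable section

-- D-0017: `Summit.<S>.<S>.…` is the designed namespace of a single-problem summit.
set_option linter.dupNamespace false

open Complex MeasureTheory Set Filter Topology
open scoped Real ENNReal

namespace Summit.RiemannHypothesis.RiemannHypothesis.Theorems.Splittings.NbSharpConstantRosser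

open Summit.RiemannHypothesis.RiemannHypothesis.Theses.NymanBeurling
open Summit.RiemannHypothesis.RiemannHypothesis.Theorems
open Summit.RiemannHypothesis.RiemannHypothesis.Theorems.Splittings.NbSharpConstant
open Literature.NumberTheory.LFunctions Literature.Barriers.RiemannHypothesis

-- Nicolas's `β = 2+γ−log π−2 log 2` is the printed NB constant `2+γ−log 4π`: this is the landed
-- `Literature.NumberTheory.LFunctions.BCF.nicolasBeta_eq` (BettinConreyFarmer2013Proofs; not restated — dedup).

/-- **Rosser's identity, with multiplicity, under RH: `Σ_ρ m_ρ/|ρ|² = 2 + γ − log 4π`** — exactly the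
hypothesis `hRosser` of `NbSharpConstant.rh_and_simple_of_sharpRate_numeric`, discharged from the tree's
RH-free `Σ_ρ m_ρ/(ρ(1−ρ)) = β` and `ρ(1−ρ) = |ρ|²` on the critical line.
[cite: Nicolas2012, (1.3) and (1.19)] [cite: LandreauRichard2002, p. 2 (Rosser 1939)] -/
theorem zeroSum_mult_div_normSq_eq_of_rh (hRH : _root_.RiemannHypothesis) :
    ∑' ρ : ZetaZeros.riemannZetaNontrivialZeros, (riemannZetaZeroOrder (ρ : ℂ) : ℝ) / ‖(ρ : ℂ)‖ ^ 2 =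
      2 + Real.eulerMascheroniConstant - Real.log (4 * π) := by
  have h : HasSum (fun ρ : ZetaZeros.riemannZetaNontrivialZeros ↦
      (riemannZetaZeroOrder (ρ : ℂ) : ℝ) / ‖(ρ : ℂ)‖ ^ 2) nicolasBeta :=
    hasSum_zeroOrder_div_norm_sq_of_RH hRH
  rw [h.tsum_eq, BCF.nicolasBeta_eq]

/-- **nb/neg g5 — the printed constant, hypothesis-free.** Landreau–Richard's Conjecture 1.4 / BDBLS (*),
in limsup form with the NUMERIC constant — `∀ ε > 0, ∀ᶠ N, ∃ a, I(N,a) ≤ (2π(2+γ−log 4π) + ε)/log N` —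
forces RH AND the simplicity of every nontrivial zero.  (`_numeric` of g4 with `hRosser` discharged by
`zeroSum_mult_div_normSq_eq_of_rh`.) [cite: LandreauRichard2002, Conj. 1.4] [cite: Burnol2002, Thm. 1.3] -/
theorem rh_and_simple_of_sharpRate_printed
    (h : ∀ ε : ℝ, 0 < ε → ∀ᶠ N : ℕ in atTop, ∃ a : Fin N → ℂ, ∫⁻ t : ℝ, ENNReal.ofReal (‖1 - riemannZeta (1 / 2 + t * Complex.I) *
        ∑ n : Fin N, a n * ((n : ℂ) + 1) ^ (-(1 / 2 + t * Complex.I))‖ ^ 2 / (1 / 4 + t ^ 2)) ≤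
      ENNReal.ofReal ((2 * π * (2 + Real.eulerMascheroniConstant - Real.log (4 * π)) + ε) / Real.log N)) :
    _root_.RiemannHypothesis ∧
      ∀ ρ ∈ ZetaZeros.riemannZetaNontrivialZeros, riemannZetaZeroOrder ρ = 1 :=
  rh_and_simple_of_sharpRate_numeric zeroSum_mult_div_normSq_eq_of_rh h

/-- **nb/neg g5 — Bettin–Conrey–Farmer's conclusion forces their implicit hypothesis.** If the NATURAL
approximants `V_N(s) = Σ_{n≤N} μ(n)(1 − log n/log N) n^{-s}` satisfy
`I(V_N) ≤ (2π(2+γ−log 4π) + ε)/log N` eventually, for every `ε > 0` (the limsup half of the conclusion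
`d²(V_N) ~ (2+γ−log 4π)/log N` of BCF 2013 Thm 1, there derived from RH and the moment hypothesis (2)
«which implicitly assumes that the zeros are all simple», p. 3), then RH holds and all nontrivial zeros
ARE simple — hypothesis-free. [cite: BettinConreyFarmer2013, Thm. 1 and p. 3] -/
theorem rh_and_simple_of_natural_sharpRate_printed
    (h : ∀ ε : ℝ, 0 < ε → ∀ᶠ N : ℕ in atTop, ∫⁻ t : ℝ, ENNReal.ofReal (‖1 - riemannZeta (1 / 2 + t * Complex.I) *
        ∑ n : Fin N, ((ArithmeticFunction.moebius (n + 1) : ℝ) *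
          (1 - Real.log ((n : ℝ) + 1) / Real.log N) : ℂ) * ((n : ℂ) + 1) ^ (-(1 / 2 + t * Complex.I))‖ ^ 2 /
            (1 / 4 + t ^ 2)) ≤
      ENNReal.ofReal ((2 * π * (2 + Real.eulerMascheroniConstant - Real.log (4 * π)) + ε) / Real.log N)) :
    _root_.RiemannHypothesis ∧
      ∀ ρ ∈ ZetaZeros.riemannZetaNontrivialZeros, riemannZetaZeroOrder ρ = 1 :=
  rh_and_simple_of_sharpRate_printed fun ε hε ↦ (h ε hε).mono fun _ hN ↦ ⟨_, hN⟩

/-- **nb/neg g5 — the ε-free printed tail (census V27) is RH-PLUS.** `TailSharp₀(H) :≡ ∀ N ≥ H, ∃ a,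
I(N,a) ≤ 2π(2+γ−log 4π)/log N` (the conjectured LIMIT constant imposed at every level beyond `H`, no `ε`)
forces RH and the simplicity of every nontrivial zero.  (On the hub's certified `d_N²` table this tail
is FALSE for every `H ≤ 2679`: `d_N² log N > 2+γ−log 4π` on `N ∈ [1838, 2679]`; card §11.)
[cite: LandreauRichard2002, Conj. 1.4 and Fig. 3] -/
theorem rh_and_simple_of_sharpTail_exact {H : ℕ}
    (h : ∀ N : ℕ, H ≤ N → ∃ a : Fin N → ℂ, ∫⁻ t : ℝ, ENNReal.ofReal (‖1 - riemannZeta (1 / 2 + t * Complex.I) *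
        ∑ n : Fin N, a n * ((n : ℂ) + 1) ^ (-(1 / 2 + t * Complex.I))‖ ^ 2 / (1 / 4 + t ^ 2)) ≤
      ENNReal.ofReal ((2 * π * (2 + Real.eulerMascheroniConstant - Real.log (4 * π))) / Real.log N)) :
    _root_.RiemannHypothesis ∧
      ∀ ρ ∈ ZetaZeros.riemannZetaNontrivialZeros, riemannZetaZeroOrder ρ = 1 := by
  refine rh_and_simple_of_sharpRate_printed fun ε hε ↦ eventually_atTop.2 ⟨H, fun N hN ↦ ?_⟩
  obtain ⟨a, ha⟩ := h N hN
  refine ⟨a, ha.trans (ENNReal.ofReal_le_ofReal ?_)⟩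
  exact div_le_div_of_nonneg_right (by linarith) (Real.log_natCast_nonneg N)

/-- Under RH alone the BDBLS constant is at most the printed one: `S₁ = Σ_ρ 1/|ρ|² ≤ 2+γ−log 4π`
(termwise `1 ≤ m_ρ`; equality iff all zeros are simple). [cite: Burnol2002, Thm. 1.2–1.3] -/
theorem zeroSumInvNormSq_le_printed_of_rh (hRH : _root_.RiemannHypothesis) :
    zeroSumInvNormSq ≤ 2 + Real.eulerMascheroniConstant - Real.log (4 * π) := by
  have hS : HasSum (fun ρ : ZetaZeros.riemannZetaNontrivialZeros ↦
      (riemannZetaZeroOrder (ρ : ℂ) : ℝ) / ‖(ρ : ℂ)‖ ^ 2) nicolasBeta :=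
    hasSum_zeroOrder_div_norm_sq_of_RH hRH
  have hle : ∀ ρ : ZetaZeros.riemannZetaNontrivialZeros,
      1 / ‖(ρ : ℂ)‖ ^ 2 ≤ (riemannZetaZeroOrder (ρ : ℂ) : ℝ) / ‖(ρ : ℂ)‖ ^ 2 := fun ρ ↦
    div_le_div_of_nonneg_right (one_le_zeroOrder_of_mem ρ.2) (sq_nonneg _)
  have h0 : ∀ ρ : ZetaZeros.riemannZetaNontrivialZeros, 0 ≤ 1 / ‖(ρ : ℂ)‖ ^ 2 := fun ρ ↦ by positivity
  have hs : Summable fun ρ : ZetaZeros.riemannZetaNontrivialZeros ↦ 1 / ‖(ρ : ℂ)‖ ^ 2 :=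
    Summable.of_nonneg_of_le h0 hle hS.summable
  calc zeroSumInvNormSq = ∑' ρ : ZetaZeros.riemannZetaNontrivialZeros, 1 / ‖(ρ : ℂ)‖ ^ 2 := rfl
    _ ≤ ∑' ρ : ZetaZeros.riemannZetaNontrivialZeros, (riemannZetaZeroOrder (ρ : ℂ) : ℝ) / ‖(ρ : ℂ)‖ ^ 2 :=
        hs.tsum_le_tsum hle hS.summable
    _ = _ := by rw [hS.tsum_eq, BCF.nicolasBeta_eq]

/-- Under `SharpRateNumeric` the two printed forms of (*) coincide: the BDBLS constant
`S₁ = Σ_ρ 1/|ρ|²` EQUALS `2+γ−log 4π` (RH and simplicity are forced, then Rosser's identity applies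
termwise with `m_ρ = 1`). [cite: LandreauRichard2002, Thm. 1.3 and Conj. 1.4] -/
theorem zeroSumInvNormSq_eq_printed_of_sharpRate_printed
    (h : ∀ ε : ℝ, 0 < ε → ∀ᶠ N : ℕ in atTop, ∃ a : Fin N → ℂ, ∫⁻ t : ℝ, ENNReal.ofReal (‖1 - riemannZeta (1 / 2 + t * Complex.I) *
        ∑ n : Fin N, a n * ((n : ℂ) + 1) ^ (-(1 / 2 + t * Complex.I))‖ ^ 2 / (1 / 4 + t ^ 2)) ≤
      ENNReal.ofReal ((2 * π * (2 + Real.eulerMascheroniConstant - Real.log (4 * π)) + ε) / Real.log N)) :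
    zeroSumInvNormSq = 2 + Real.eulerMascheroniConstant - Real.log (4 * π) := by
  obtain ⟨hRH, hsimple⟩ := rh_and_simple_of_sharpRate_printed h
  rw [← zeroSum_mult_div_normSq_eq_of_rh hRH]
  refine tsum_congr fun ρ ↦ ?_
  rw [hsimple (ρ : ℂ) ρ.2]
  push_cast
  rfl

end Summit.RiemannHypothesis.RiemannHypothesis.Theorems.Splittings.NbSharpConstantRosser

end
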